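import Mathlib
import Summits.NavierStokesRegularity.NavierStokesRegularity.Theorems.TaoLadderRungTwoBreakOneShiftWindowStepPairSlope
import HarnessLib

/-!
# The one-shift window system, XVII: the two C⁰ step estimates in Kapela–Zgliczyński form — the INCLUSION
# DEVIATION of a rough-tail run from its centre companion (SPEC Δ_s / D_s) and the TAIL SENSITIVITY of two runs
# with different tails (SPEC χ-vectors, the (K2) input of part XII) (cell harvest/h2-tao-ladder, seat p2;
# rung1/KERNEL-CHEAP-REPLAY-SPEC.md §2 (d)/(f), §3 S1/S5, §6 (v); support for K1(1) = `NoSurvivingDSSOne`,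
# stmt-NavierStokesRegularity-20205)

MODEL lattice ODEs only (Tao 2016 §4 normal form on Tao's shift set `S`); nothing here is a statement about
the Navier–Stokes equations; no item is closed; nothing numerical is proved. Generic in the index type `ι`; the
fields are abstract; both theorems are instances of part XV `abs_forcedDeviation_le` with the slope structure of
part XIV `exists_slopeMatrix_rows_on_segment`.

* `abs_stepDeviation_le` — a run `S` of the rough field `f t` and the run `C` of the centre field `fc` from the
  SAME start, both in the convex hull `Hs` on `[0, h)`; centre-Jacobian bounds `dg`, `R` on `Hs`; the field
  deviation `|f t x − fc x|_i ≤ cb_i` on `Hs` (inclusion half-widths); K–Z vector fixed point `(R Ẑ + cb) ∘ E ≤ Ẑ` and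
  a contraction direction ⇒ `|S(t) − C(t)|_i ≤ Ẑ_i` on `[0, h]` (the within-step deviation `Δ_s`; with a nonzero
  start difference, see the sensitivity form);
* `abs_stepSensitivity_le` — two runs `S`, `S'` of two rough fields `f t`, `f₂ t` (two tail realisations) whose
  start difference `p` satisfies `|p| ≤ pb B + pe E`; Jacobian bounds `dg`, `R`, `Ab` of `f t` on `Hs`; the field
  difference `|f t x − f₂ t x|_i ≤ cb_i B + ce_i E` on `Hs`; K–Z fixed points with forcings `cb + Ab pb`, `ce + Ab pe` ⇒
  `|S(t) − S'(t)|_i ≤ (pb_i + Ẑb_i) B + (pe_i + Ẑe_i) E` on `[0, h]` — one step of the χ-recursion.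
-/

noncomputable section

-- the sub-problem namespace repeats the summit name by design (D-0017)
set_option linter.dupNamespace false

namespace Summit.NavierStokesRegularity.NavierStokesRegularity.Theorems

namespace DSSOneShift

open Set Metric Filter Topology Literature.Analysis.ODE

variable {ι : Type*} [Fintype ι] [DecidableEq ι]

/-- **THE INCLUSION DEVIATION OF ONE STEP.** A run `S` of the rough field and the run `C` of the centre field from
the same start, both in the convex hull `Hs` on `[0, h)`; the centre field has within `Hs` the derivative `fc' x`
with diagonal `≤ dg` and off-diagonal magnitudes `≤ R`; the rough field deviates from the centre field by at most
`cb` componentwise on `Hs`; `E_i ≥ ∫₀ʰ e^{dg_i r} dr`, `(Σ_j R_ij Ẑ_j + cb_i) E_i ≤ Ẑ_i`, and a contraction direction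
`ζ > 0`. Then `|S(t) − C(t)|_i ≤ Ẑ_i` on `[0, h]`. [cite: KapelaZgliczynski2009, §4 Lemma 8 / Thm. 9; cell vocabulary, harvest/h2-tao-ladder rung1/KERNEL-CHEAP-REPLAY-SPEC.md §2 (d) (Δ_s)] -/
theorem abs_stepDeviation_le {h : ℝ} (hh : 0 ≤ h) {Hs : Set (ι → ℝ)} (hHs : Convex ℝ Hs)
    {f : ℝ → (ι → ℝ) → ι → ℝ} {fc : (ι → ℝ) → ι → ℝ} {fc' : (ι → ℝ) → (ι → ℝ) →L[ℝ] (ι → ℝ)}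
    {S C : ℝ → ι → ℝ}
    (hS : ∀ t ∈ Icc 0 h, HasDerivWithinAt S (f t (S t)) (Icc 0 h) t)
    (hC : ∀ t ∈ Icc 0 h, HasDerivWithinAt C (fc (C t)) (Icc 0 h) t) (h0 : S 0 = C 0)
    (hmem : ∀ t ∈ Ico 0 h, S t ∈ Hs ∧ C t ∈ Hs)
    (hfc : ∀ x ∈ Hs, HasFDerivWithinAt fc (fc' x) Hs x)
    {dg cb Zb E ζ : ι → ℝ} {R : ι → ι → ℝ}
    (hdg : ∀ x ∈ Hs, ∀ i, (fc' x) (Pi.single i 1) i ≤ dg i)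
    (hR0 : ∀ i j, 0 ≤ R i j) (hR : ∀ x ∈ Hs, ∀ i j, i ≠ j → |(fc' x) (Pi.single j 1) i| ≤ R i j)
    (hcb : ∀ i, 0 ≤ cb i) (hδ : ∀ t ∈ Ico 0 h, ∀ x ∈ Hs, ∀ i, |f t x i - fc x i| ≤ cb i)
    (hZb : ∀ i, 0 ≤ Zb i) (hE : ∀ i, gronwallBound 0 (dg i) 1 h ≤ E i)
    (hfix : ∀ i, ((∑ j, R i j * Zb j) + cb i) * E i ≤ Zb i)
    (hζ0 : ∀ i, 0 < ζ i) (hζ : ∀ i, (∑ j, R i j * ζ j) * E i ≤ ζ i) :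
    ∀ t ∈ Icc 0 h, ∀ i, |S t i - C t i| ≤ Zb i := by
  classical
  set y : ℝ → ι → ℝ := fun t => S t - C t with hy
  set y' : ℝ → ι → ℝ := fun t => f t (S t) - fc (C t) with hy'
  have hyd : ∀ t ∈ Icc 0 h, HasDerivWithinAt y (y' t) (Icc 0 h) t := fun t ht => (hS t ht).sub (hC t ht)
  have hy0 : y 0 = 0 := by simp [hy, h0]
  have hstruct : ∀ t ∈ Ico 0 h, ∃ (A : Matrix ι ι ℝ) (δ : ι → ℝ), y' t = A.mulVec (y t) + δ ∧
      (∀ i, A i i ≤ dg i) ∧ (∀ i j, i ≠ j → |A i j| ≤ R i j) ∧ (∀ i, |δ i| ≤ cb i * 1 + (0 : ℝ) * 0) := by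
    intro t ht
    obtain ⟨hSH, hCH⟩ := hmem t ht
    obtain ⟨z, hz, hzrep⟩ := exists_slopeMatrix_rows_on_segment hHs hfc hSH hCH
    have hzH : ∀ i, z i ∈ Hs := fun i => hHs.segment_subset hSH hCH (hz i)
    refine ⟨Matrix.of fun i j => (fc' (z i)) (Pi.single j 1) i, fun i => f t (S t) i - fc (S t) i, ?_,
      fun i => hdg (z i) (hzH i) i, fun i j hij => hR (z i) (hzH i) i j hij, fun i => ?_⟩
    · ext i
      have hrow := congrFun hzrep i
      simp only [Pi.sub_apply] at hrow
      simp only [hy', hy, Pi.sub_apply, Pi.add_apply]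
      rw [← hrow]
      ring
    · simpa using hδ t ht (S t) hSH i
  have hres := abs_forcedDeviation_le (B := 1) (E := 0) (ce := fun _ => 0) (Ze := fun _ => 0) hh hyd hy0
    zero_le_one le_rfl hR0 hcb (fun _ => le_rfl) hZb (fun _ => le_rfl) hstruct hE
    (fun i => by simpa using hfix i) (fun i => by simp) hζ0 hζ
  intro t ht i
  simpa [hy] using hres t ht i

/-- **THE TAIL SENSITIVITY OF ONE STEP.** Two runs `S`, `S'` of two rough fields `f t`, `f₂ t` (the same window
system with two admissible tail realisations) in the convex hull `Hs` on `[0, h)`, whose start difference `p`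
satisfies `|p_i| ≤ pb_i B + pe_i E`; the first field has within `Hs` the derivative `f' t x` with diagonal `≤ dg`,
off-diagonal magnitudes `≤ R` and all magnitudes `≤ Ab`; the two fields differ by at most `cb_i B + ce_i E`
componentwise on `Hs` (`B`, `E` = the sup-differences of the wake / top tails); weights `E`, the K–Z vector fixed
points `(Σ_j R_ij Ẑb_j + cb_i + Σ_j Ab_ij pb_j) Ew_i ≤ Ẑb_i`, `(Σ_j R_ij Ẑe_j + ce_i + Σ_j Ab_ij pe_j) Ew_i ≤ Ẑe_i` and a
contraction direction. Then `|S(t) − S'(t)|_i ≤ (pb_i + Ẑb_i) B + (pe_i + Ẑe_i) E` on `[0, h]`.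
[cite: KapelaZgliczynski2009, §4 Lemma 8 / Thm. 9; cell vocabulary, harvest/h2-tao-ladder rung1/KERNEL-CHEAP-REPLAY-SPEC.md §3 S5 (χ-vectors), rung1/STAGE3-BANACH.md §2] -/
theorem abs_stepSensitivity_le {h : ℝ} (hh : 0 ≤ h) {Hs : Set (ι → ℝ)} (hHs : Convex ℝ Hs)
    {f f₂ : ℝ → (ι → ℝ) → ι → ℝ} {f' : ℝ → (ι → ℝ) → (ι → ℝ) →L[ℝ] (ι → ℝ)} {S S₂ : ℝ → ι → ℝ}
    (hS : ∀ t ∈ Icc 0 h, HasDerivWithinAt S (f t (S t)) (Icc 0 h) t)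
    (hS₂ : ∀ t ∈ Icc 0 h, HasDerivWithinAt S₂ (f₂ t (S₂ t)) (Icc 0 h) t)
    (hmem : ∀ t ∈ Ico 0 h, S t ∈ Hs ∧ S₂ t ∈ Hs)
    (hf : ∀ t ∈ Ico 0 h, ∀ x ∈ Hs, HasFDerivWithinAt (f t) (f' t x) Hs x)
    {dg cb ce pb pe Zb Ze Ew ζ : ι → ℝ} {R Ab : ι → ι → ℝ} {B E : ℝ} (hB : 0 ≤ B) (hE0 : 0 ≤ E)
    (hdg : ∀ t ∈ Ico 0 h, ∀ x ∈ Hs, ∀ i, (f' t x) (Pi.single i 1) i ≤ dg i)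
    (hR0 : ∀ i j, 0 ≤ R i j) (hR : ∀ t ∈ Ico 0 h, ∀ x ∈ Hs, ∀ i j, i ≠ j → |(f' t x) (Pi.single j 1) i| ≤ R i j)
    (hAb0 : ∀ i j, 0 ≤ Ab i j) (hAb : ∀ t ∈ Ico 0 h, ∀ x ∈ Hs, ∀ i j, |(f' t x) (Pi.single j 1) i| ≤ Ab i j)
    (hcb : ∀ i, 0 ≤ cb i) (hce : ∀ i, 0 ≤ ce i) (hpb : ∀ i, 0 ≤ pb i) (hpe : ∀ i, 0 ≤ pe i)
    (hp : ∀ i, |S 0 i - S₂ 0 i| ≤ pb i * B + pe i * E)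
    (hδ : ∀ t ∈ Ico 0 h, ∀ x ∈ Hs, ∀ i, |f t x i - f₂ t x i| ≤ cb i * B + ce i * E)
    (hZb : ∀ i, 0 ≤ Zb i) (hZe : ∀ i, 0 ≤ Ze i) (hEw : ∀ i, gronwallBound 0 (dg i) 1 h ≤ Ew i)
    (hfixb : ∀ i, ((∑ j, R i j * Zb j) + (cb i + ∑ j, Ab i j * pb j)) * Ew i ≤ Zb i)
    (hfixe : ∀ i, ((∑ j, R i j * Ze j) + (ce i + ∑ j, Ab i j * pe j)) * Ew i ≤ Ze i)
    (hζ0 : ∀ i, 0 < ζ i) (hζ : ∀ i, (∑ j, R i j * ζ j) * Ew i ≤ ζ i) :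
    ∀ t ∈ Icc 0 h, ∀ i, |S t i - S₂ t i| ≤ (pb i + Zb i) * B + (pe i + Ze i) * E := by
  classical
  -- the difference minus its start value
  set p : ι → ℝ := S 0 - S₂ 0 with hpdef
  set y : ℝ → ι → ℝ := fun t => S t - S₂ t - p with hy
  set y' : ℝ → ι → ℝ := fun t => f t (S t) - f₂ t (S₂ t) with hy'
  have hyd : ∀ t ∈ Icc 0 h, HasDerivWithinAt y (y' t) (Icc 0 h) t := fun t ht =>
    ((hS t ht).sub (hS₂ t ht)).sub_const p
  have hy0 : y 0 = 0 := by simp [hy, hpdef]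
  have hcb' : ∀ i, 0 ≤ cb i + ∑ j, Ab i j * pb j := fun i =>
    add_nonneg (hcb i) (Finset.sum_nonneg fun j _ => mul_nonneg (hAb0 i j) (hpb j))
  have hce' : ∀ i, 0 ≤ ce i + ∑ j, Ab i j * pe j := fun i =>
    add_nonneg (hce i) (Finset.sum_nonneg fun j _ => mul_nonneg (hAb0 i j) (hpe j))
  have hstruct : ∀ t ∈ Ico 0 h, ∃ (A : Matrix ι ι ℝ) (δ : ι → ℝ), y' t = A.mulVec (y t) + δ ∧
      (∀ i, A i i ≤ dg i) ∧ (∀ i j, i ≠ j → |A i j| ≤ R i j) ∧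
      (∀ i, |δ i| ≤ (cb i + ∑ j, Ab i j * pb j) * B + (ce i + ∑ j, Ab i j * pe j) * E) := by
    intro t ht
    obtain ⟨hSH, hS₂H⟩ := hmem t ht
    obtain ⟨z, hz, hzrep⟩ := exists_slopeMatrix_rows_on_segment hHs (hf t ht) hSH hS₂H
    have hzH : ∀ i, z i ∈ Hs := fun i => hHs.segment_subset hSH hS₂H (hz i)
    set A : Matrix ι ι ℝ := Matrix.of fun i j => (f' t (z i)) (Pi.single j 1) i with hA
    refine ⟨A, fun i => (A.mulVec p) i + (f t (S₂ t) i - f₂ t (S₂ t) i), ?_, fun i => hdg t ht (z i) (hzH i) i,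
      fun i j hij => hR t ht (z i) (hzH i) i j hij, fun i => ?_⟩
    · -- `y' = [f(S) − f(S₂)] + [f(S₂) − f₂(S₂)] = A (S − S₂) + δ₀ = A y + (A p + δ₀)`
      ext i
      have hrow := congrFun hzrep i
      simp only [Pi.sub_apply] at hrow
      have hlin : (A.mulVec (S t - S₂ t)) i = (A.mulVec (y t)) i + (A.mulVec p) i := by
        rw [← Pi.add_apply, ← Matrix.mulVec_add]
        congr 2
        ext j; simp [hy]
      simp only [hy', Pi.sub_apply, Pi.add_apply]
      linarith [hrow, hlin]
    · have h1 : |(A.mulVec p) i| ≤ ∑ j, Ab i j * (pb j * B + pe j * E) := by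
        simp only [Matrix.mulVec, dotProduct]
        refine (Finset.abs_sum_le_sum_abs _ _).trans (Finset.sum_le_sum fun j _ => ?_)
        rw [abs_mul]
        exact mul_le_mul (by simpa [hA] using hAb t ht (z i) (hzH i) i j) (hp j) (abs_nonneg _) (hAb0 i j)
      have h2 := hδ t ht (S₂ t) hS₂H i
      have e : ∑ j, Ab i j * (pb j * B + pe j * E) = (∑ j, Ab i j * pb j) * B + (∑ j, Ab i j * pe j) * E := by
        rw [Finset.sum_mul, Finset.sum_mul, ← Finset.sum_add_distrib]
        exact Finset.sum_congr rfl fun j _ => by ring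
      calc |(A.mulVec p) i + (f t (S₂ t) i - f₂ t (S₂ t) i)|
          ≤ |(A.mulVec p) i| + |f t (S₂ t) i - f₂ t (S₂ t) i| := abs_add_le _ _
        _ ≤ (∑ j, Ab i j * pb j) * B + (∑ j, Ab i j * pe j) * E + (cb i * B + ce i * E) := by
            rw [← e]; exact add_le_add h1 h2
        _ = (cb i + ∑ j, Ab i j * pb j) * B + (ce i + ∑ j, Ab i j * pe j) * E := by ring
  have hres := abs_forcedDeviation_le hh hyd hy0 hB hE0 hR0 hcb' hce' hZb hZe hstruct hEw hfixb hfixe hζ0 hζ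
  intro t ht i
  have h1 := hres t ht i
  have h2 := hp i
  have e : S t i - S₂ t i = y t i + p i := by simp [hy, hpdef]
  rw [e]
  calc |y t i + p i| ≤ |y t i| + |p i| := abs_add_le _ _
    _ ≤ (Zb i * B + Ze i * E) + (pb i * B + pe i * E) := add_le_add h1 (by simpa [hpdef] using h2)
    _ = (pb i + Zb i) * B + (pe i + Ze i) * E := by ring

end DSSOneShift

end Summit.NavierStokesRegularity.NavierStokesRegularity.Theorems
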